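import Summits.CriticalPhenomena.CardyFormulaZ2.Theorems.CardyFlipRussoVoronoiHubFromSmirnovVoidBallIntensity
import Summits.CriticalPhenomena.CardyFormulaZ2.Theorems.CardyFlipRussoVoronoiHubFromSmirnovGridNet
import Summits.CriticalPhenomena.CardyFormulaZ2.Theorems.CardyFlipRussoVoronoiHubFromSmirnovInsertMono

/-!
# Stub `poisson_noVoid_tendsto` of line `moebius-exact-delaunay-dilation-ward`
# (crux `VoronoiHubFromSmirnov`, stmt-CriticalPhenomena-6433)

NO GIANT CELLS over a compact set, for the inhomogeneous admissible model at `t = 1`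
(I. Benjamini, O. Schramm, *Conformal invariance of Voronoi percolation*, Comm. Math. Phys. 197
(1998) 75–107, Lemma 5.5 "no giant tiles", inhomogeneous intensity bounded below): for an
admissible profile `ρ` and a compact `K ⊆ ℂ` there is a constant `C > 0` such that, as the mesh
`δ → 0⁺`, with probability `→ 1` every physical point `z ∈ K` has a nucleus of
`poissonLaw (intensity ρ 1 δ)` within configuration distance `C √|log δ|` of `z / δ`.

Proof.
* `ρ ≥ m > 0` (`AdmissibleDensity.exists_pos_forall_le`), so with `m₀ := min 1 m` the intensity
  dominates `m₀ · Leb` (`min_le_densityPath`, `ofReal_mul_volume_le_intensity`); it is locally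
  finite (`im_isLocallyFiniteMeasure_intensity`) and `poissonLaw (intensity ρ 1 δ)` is a Poisson
  law of this intensity (`isPoissonPointProcess_poissonLaw_intensity`).
* Choose `C := 3 √(3 / (m₀ π))`, so that `m₀ π (s/3)² = 3 |log δ|` for `s := C √|log δ|`, i.e.
  the void probability of a ball of radius `s/3` is at most `exp (-3 |log δ|) = δ³` (`δ < 1`).
* `K ⊆ closedBall 0 r₀`, so `A := K / δ ⊆ closedBall 0 (r₀/δ + s/3)`; the grid net
  `exists_finset_net_closedBall` covers `A` by at most `(12 r₀/(δ s) + 5)²` balls of radius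
  `s/3`, and the landed union bound `poisson_voidBall_unionBound_of_le_intensity` gives
  `P {∃ z ∈ A, no nucleus within s of z} ≤ (12 r₀/(δ s) + 5)² δ³ ≤ (12 r₀/C + 5)² δ` for
  `δ < e⁻¹` (then `|log δ| ≥ 1`, so `s ≥ C`).
* Squeeze (`squeeze_zero'`): probabilities are `≥ 0` and `(12 r₀/C + 5)² δ → 0`.

No new definitions; tree facts and Mathlib only.
-/

noncomputable section

namespace Summit.CriticalPhenomena.CardyFormulaZ2.Cruxes.VoronoiHubFromSmirnov.MoebiusExactDelaunayDilationWard

open scoped Topology ENNReal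
open Filter Set MeasureTheory Metric
open Literature.Analysis.FunctionSpaces
open Literature.Probability.RandomPlanarGeometry

/-- The void event over `K` in physical coordinates is the void event over the rescaled set
`K / δ` in configuration coordinates. [folklore] -/
theorem nv_voidEvent_eq_image (K : Set ℂ) (δ s : ℝ) :
    {c : PointConfig ℂ | ∃ z ∈ K, ∀ q ∈ c, s ≤ dist q (z / (δ : ℂ))} =
      {c : PointConfig ℂ | ∃ z ∈ (fun z : ℂ => z / (δ : ℂ)) '' K, ∀ q ∈ c, s ≤ dist q z} := by
  ext c
  simp only [mem_setOf_eq, exists_mem_image]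

/-- The rescaled set `K / δ` of a set `K ⊆ closedBall 0 r₀` lies in `closedBall 0 (r₀/δ + e)`
for every `e ≥ 0` (`δ > 0`). [folklore] -/
theorem nv_image_subset_closedBall {K : Set ℂ} {r₀ : ℝ} (hK : K ⊆ closedBall 0 r₀) {δ : ℝ}
    (hδ : 0 < δ) {e : ℝ} (he : 0 ≤ e) :
    (fun z : ℂ => z / (δ : ℂ)) '' K ⊆ closedBall 0 (r₀ / δ + e) := by
  rintro _ ⟨z, hz, rfl⟩
  have h := hK hz
  rw [mem_closedBall, dist_zero_right] at h ⊢
  rw [norm_div, Complex.norm_of_nonneg hδ.le]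
  exact (div_le_div_of_nonneg_right h hδ.le).trans (le_add_of_nonneg_right he)

/-- The choice of the constant: if `C² = 27 / (m₀ π)` and `s = C √|log δ|` with `0 < δ < 1`, then
the void probability bound of a ball of radius `s/3` is `exp (-(m₀ π (s/3)²)) = δ³`. [folklore] -/
theorem nv_exp_eq_pow {m₀ C s δ : ℝ} (hm₀ : 0 < m₀) (hC2 : C ^ 2 = 27 / (m₀ * Real.pi))
    (hsC : s = C * Real.sqrt |Real.log δ|) (hδ : 0 < δ) (hδ1 : δ < 1) :
    Real.exp (-(m₀ * Real.pi * (s / 3) ^ 2)) = δ ^ 3 := by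
  have hlog : |Real.log δ| = -Real.log δ := abs_of_neg (Real.log_neg hδ hδ1)
  have hπ : Real.pi ≠ 0 := Real.pi_pos.ne'
  have h1 : m₀ * Real.pi * (s / 3) ^ 2 = -((3 : ℕ) * Real.log δ) := by
    rw [hsC, div_pow, mul_pow, Real.sq_sqrt (abs_nonneg _), hC2, hlog]
    field_simp
    push_cast
    ring
  rw [h1, neg_neg, Real.exp_nat_mul, Real.exp_log hδ]

/-- The counting arithmetic: `(12 r₀/(δ s) + 5)² δ³ ≤ (12 r₀/C + 5)² δ` for `0 < C ≤ s`,
`0 < δ ≤ 1`, `r₀ ≥ 0` (the net has `(4 (r₀/δ + s/3)/(s/3) + 1)² = (12 r₀/(δ s) + 5)²` points).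
[folklore] -/
theorem nv_count_mul_le {r₀ C s δ : ℝ} (hr₀ : 0 ≤ r₀) (hC : 0 < C) (hCs : C ≤ s) (hδ : 0 < δ)
    (hδ1 : δ ≤ 1) :
    (4 * (r₀ / δ + s / 3) / (s / 3) + 1) ^ 2 * δ ^ 3 ≤ (12 * r₀ / C + 5) ^ 2 * δ := by
  have hs : 0 < s := hC.trans_le hCs
  have hT : (4 * (r₀ / δ + s / 3) / (s / 3) + 1) * δ = 12 * r₀ / s + 5 * δ := by
    field_simp
    ring
  have hT0 : 0 ≤ (4 * (r₀ / δ + s / 3) / (s / 3) + 1) * δ := by positivity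
  have hle : (4 * (r₀ / δ + s / 3) / (s / 3) + 1) * δ ≤ 12 * r₀ / C + 5 := by
    rw [hT]
    have h1 : 12 * r₀ / s ≤ 12 * r₀ / C := div_le_div_of_nonneg_left (by positivity) hC hCs
    nlinarith
  calc (4 * (r₀ / δ + s / 3) / (s / 3) + 1) ^ 2 * δ ^ 3
      = ((4 * (r₀ / δ + s / 3) / (s / 3) + 1) * δ) ^ 2 * δ := by ring
    _ ≤ (12 * r₀ / C + 5) ^ 2 * δ :=
        mul_le_mul_of_nonneg_right (pow_le_pow_left₀ hT0 hle 2) hδ.le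

/-- **No giant cells over a compact set** (Benjamini–Schramm 1998, Lemma 5.5, for the
inhomogeneous admissible model at `t = 1`): for an admissible profile `ρ` and a compact `K` there
is `C > 0` such that the probability that some physical point `z ∈ K` has no nucleus of
`poissonLaw (intensity ρ 1 δ)` within configuration distance `C √|log δ|` of `z/δ` tends to `0`
as `δ → 0⁺` (it is `O(δ)` for `C = 3 √(3/(m₀ π))`, `m₀ = min 1 (inf ρ)`). -/
theorem poisson_noVoid_tendsto : ∀ (ρ : ℂ → ℝ), AdmissibleDensity ρ → ∀ (K : Set ℂ), IsCompact K → ∃ C : ℝ, 0 < C ∧ Filter.Tendsto (fun δ : ℝ => (poissonLaw (intensity ρ 1 δ)).real {c | ∃ z ∈ K, ∀ q ∈ c, C * Real.sqrt |Real.log δ| ≤ dist q (z / (δ : ℂ))}) (nhdsWithin (0 : ℝ) (Set.Ioi 0)) (nhds 0) := by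
  intro ρ hρ K hK
  -- a positive lower bound of the profile, hence of the density at `t = 1`
  obtain ⟨m, hm0, hm⟩ := hρ.exists_pos_forall_le
  have hm₀ : 0 < min 1 m := lt_min one_pos hm0
  have hmd : ∀ x, min 1 m ≤ densityPath ρ 1 x := fun x =>
    min_le_densityPath hm ⟨zero_le_one, le_rfl⟩ x
  -- a disc containing `K`
  obtain ⟨r₀, hr₀, hKr⟩ := hK.isBounded.subset_closedBall_lt 0 (0 : ℂ)
  -- the constant
  set C : ℝ := 3 * Real.sqrt (3 / (min 1 m * Real.pi)) with hCdef
  have hC : 0 < C := by positivity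
  have hC2 : C ^ 2 = 27 / (min 1 m * Real.pi) := by
    rw [hCdef, mul_pow, Real.sq_sqrt (by positivity)]
    ring
  refine ⟨C, hC, ?_⟩
  -- the majorant `M δ → 0`
  set M : ℝ := (12 * r₀ / C + 5) ^ 2 with hMdef
  have hlim : Tendsto (fun δ : ℝ => M * δ) (𝓝[>] (0 : ℝ)) (𝓝 0) := by
    have h : Tendsto (fun δ : ℝ => M * δ) (𝓝 (0 : ℝ)) (𝓝 (M * 0)) :=
      tendsto_const_nhds.mul tendsto_id
    rw [mul_zero] at h
    exact h.mono_left nhdsWithin_le_nhds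
  refine squeeze_zero' (Eventually.of_forall fun δ => measureReal_nonneg) ?_ hlim
  filter_upwards [Ioo_mem_nhdsGT (Real.exp_pos (-1))] with δ hδI
  obtain ⟨hδ, hδe⟩ := hδI
  have hδ1 : δ < 1 := hδe.trans (Real.exp_lt_one_iff.2 (by norm_num))
  have hlog : Real.log δ < -1 := by
    have h := Real.log_lt_log hδ hδe
    rwa [Real.log_exp] at h
  have habs : |Real.log δ| = -Real.log δ := abs_of_neg (by linarith)
  have hsqrt : 1 ≤ Real.sqrt |Real.log δ| := by
    rw [Real.one_le_sqrt, habs]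
    linarith
  set s : ℝ := C * Real.sqrt |Real.log δ| with hsdef
  have hCs : C ≤ s := by
    have h := mul_le_mul_of_nonneg_left hsqrt hC.le
    rwa [mul_one] at h
  have hs : 0 < s := hC.trans_le hCs
  -- the Poisson environment at `t = 1`
  have hP : IsPoissonPointProcess (intensity ρ 1 δ) (poissonLaw (intensity ρ 1 δ)) :=
    isPoissonPointProcess_poissonLaw_intensity ρ hρ.continuous 1 δ
  haveI := im_isLocallyFiniteMeasure_intensity hρ.continuous 1 δ
  have hdom : ∀ S : Set ℂ, MeasurableSet S →
      ENNReal.ofReal (min 1 m) * volume S ≤ intensity ρ 1 δ S :=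
    fun S hS => ofReal_mul_volume_le_intensity hmd δ hS
  have hfin : ∀ (x : ℂ) (r : ℝ), intensity ρ 1 δ (ball x r) ≠ ⊤ := fun x r => measure_ball_ne_top
  -- the rescaled compact set and its net
  rw [nv_voidEvent_eq_image K δ s]
  set A : Set ℂ := (fun z : ℂ => z / (δ : ℂ)) '' K with hAdef
  have hA : A ⊆ closedBall 0 (r₀ / δ + s / 3) :=
    nv_image_subset_closedBall hKr hδ (by positivity)
  obtain ⟨X, hXcard, hAX⟩ := exists_finset_net_closedBall A (s / 3) (r₀ / δ + s / 3)
    (by positivity) (le_add_of_nonneg_left (by positivity)) hA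
  -- union bound and arithmetic
  calc (poissonLaw (intensity ρ 1 δ)).real {c | ∃ z ∈ A, ∀ q ∈ c, s ≤ dist q z}
      ≤ X.card * Real.exp (-(min 1 m * Real.pi * (s / 3) ^ 2)) :=
        poisson_voidBall_unionBound_of_le_intensity (min 1 m) hP hm₀ hdom hfin A X s hs hAX
    _ ≤ (4 * (r₀ / δ + s / 3) / (s / 3) + 1) ^ 2 * δ ^ 3 := by
        rw [nv_exp_eq_pow hm₀ hC2 hsdef hδ hδ1]
        exact mul_le_mul_of_nonneg_right hXcard (by positivity)
    _ ≤ M * δ := nv_count_mul_le hr₀.le hC hCs hδ hδ1.le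

end Summit.CriticalPhenomena.CardyFormulaZ2.Cruxes.VoronoiHubFromSmirnov.MoebiusExactDelaunayDilationWard

end
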